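import Literature.MathematicalPhysics.QuantumManyBody.BoseGasHardSetRadial
import Mathlib.MeasureTheory.Function.Jacobian
import HarnessLib

/-!
# Finite line energy forces vanishing at every transversal crossing of a hard sphere

Topic `Literature/MathematicalPhysics/QuantumManyBody`, sequel of `BoseGasHardSetRadial.lean`. The one-dimensional heart of
the form-core theorem for hard-core pair potentials ("a finite-energy Sobolev function vanishes on every hard sphere",
[LSSY2005] Ch. 2 after (2.1), there for continuous wave functions — `eq_zero_of_dist_mem_hardRad`): along a line, let
`τ ↦ f(τ)` be the restriction of the wave function (continuous at `τ₀`), `τ ↦ ρ(τ)` the distance of the moving pair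
(continuous and strictly monotone near `τ₀`, differentiable with `|ρ'| ≤ K`: a TRANSVERSAL crossing of the sphere of radius
`ρ(τ₀) = r₀`), and suppose the line energy `∫ v(ρ(τ)) |f(τ)|² dτ` is finite near `τ₀`. If `r₀` is a hard radius of `v` then
`f(τ₀) = 0` (`eq_zero_of_hardRad_of_lineEnergy_ne_top`): otherwise `|f| ≥ m > 0` near `τ₀`, so `∫ v(ρ(τ)) dτ < ∞` near `τ₀`,
and the change of variables `r = ρ(τ)` (Mathlib's `lintegral_image_eq_lintegral_abs_deriv_mul`) makes `v` integrable on an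
interval around `r₀`, contradicting `lintegral_Ioo_eq_top_of_mem_hardRad`.

Tagged folklore.
-/

noncomputable section

open MeasureTheory Set Metric Filter Topology
open scoped ENNReal

namespace Literature.MathematicalPhysics.QuantumManyBody.BoseGas

variable {v : ℝ → ℝ≥0∞}

/-- **Change of variables along an injective stretch.** If `ρ` is continuous on `[a, b]` (`a < b`), injective on `(a, b)`
and differentiable there with `|ρ'| ≤ K`, then `∫_{uIoo (ρ a) (ρ b)} v ≤ K ∫_{(a,b)} v ∘ ρ` (the open interval between
`ρ a` and `ρ b` lies in the image, on which the one-dimensional area formula applies). [folklore] -/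
theorem lintegral_uIoo_image_le {ρ ρ' : ℝ → ℝ} {a b K : ℝ} (hab : a < b) (hcont : ContinuousOn ρ (Icc a b))
    (hinj : InjOn ρ (Ioo a b)) (hderiv : ∀ τ ∈ Ioo a b, HasDerivWithinAt ρ (ρ' τ) (Ioo a b) τ)
    (hK : ∀ τ ∈ Ioo a b, |ρ' τ| ≤ K) (v : ℝ → ℝ≥0∞) :
    ∫⁻ r in uIoo (ρ a) (ρ b), v r ≤ ENNReal.ofReal K * ∫⁻ τ in Ioo a b, v (ρ τ) := by
  -- the image of `(a, b)` contains the open interval between `ρ a` and `ρ b`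
  have himage : uIoo (ρ a) (ρ b) ⊆ ρ '' Ioo a b := by
    rcases le_total (ρ a) (ρ b) with h | h
    · rw [uIoo_of_le h]; exact intermediate_value_Ioo hab.le hcont
    · rw [uIoo_of_ge h]; exact intermediate_value_Ioo' hab.le hcont
  calc ∫⁻ r in uIoo (ρ a) (ρ b), v r ≤ ∫⁻ r in ρ '' Ioo a b, v r := lintegral_mono_set himage
    _ = ∫⁻ τ in Ioo a b, ENNReal.ofReal |ρ' τ| * v (ρ τ) :=
        lintegral_image_eq_lintegral_abs_deriv_mul measurableSet_Ioo hderiv hinj v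
    _ ≤ ∫⁻ τ in Ioo a b, ENNReal.ofReal K * v (ρ τ) := by
        refine setLIntegral_mono' measurableSet_Ioo fun τ hτ => ?_
        gcongr
        exact hK τ hτ
    _ = ENNReal.ofReal K * ∫⁻ τ in Ioo a b, v (ρ τ) := lintegral_const_mul' _ _ ENNReal.ofReal_ne_top

/-- **Vanishing at a transversal hard crossing.** Let `v` be measurable, `a < τ₀ < b`, `ρ` continuous and strictly
monotone (increasing or decreasing) on `[a, b]`, differentiable on `(a, b)` with `|ρ'| ≤ K`, and `ρ τ₀ ∈ hardRad v`. If
`f : ℝ → ℂ` is continuous at `τ₀` with finite line energy `∫_{(a,b)} v(ρ τ) |f τ|² dτ < ∞`, then `f τ₀ = 0`. [folklore] -/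
theorem eq_zero_of_hardRad_of_lineEnergy_ne_top (hv : Measurable v) {f : ℝ → ℂ} {ρ ρ' : ℝ → ℝ} {τ₀ a b K : ℝ}
    (ha : a < τ₀) (hb : τ₀ < b) (hcont : ContinuousOn ρ (Icc a b))
    (hmono : StrictMonoOn ρ (Icc a b) ∨ StrictAntiOn ρ (Icc a b))
    (hderiv : ∀ τ ∈ Ioo a b, HasDerivWithinAt ρ (ρ' τ) (Ioo a b) τ) (hK : ∀ τ ∈ Ioo a b, |ρ' τ| ≤ K)
    (hhard : ρ τ₀ ∈ hardRad v) (hf : ContinuousAt f τ₀) (hE : ∫⁻ τ in Ioo a b, v (ρ τ) * ‖f τ‖ₑ ^ 2 ≠ ⊤) :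
    f τ₀ = 0 := by
  by_contra h0
  -- `|f| > m := |f τ₀| / 2` on a neighbourhood `(a', b')` of `τ₀` inside `(a, b)`
  set m : ℝ := ‖f τ₀‖ / 2 with hm
  have hm0 : 0 < m := by rw [hm]; exact half_pos (norm_pos_iff.2 h0)
  obtain ⟨δ, hδ, hδf⟩ := Metric.continuousAt_iff.1 hf m hm0
  set a' : ℝ := max a (τ₀ - δ / 2) with ha'
  set b' : ℝ := min b (τ₀ + δ / 2) with hb'
  have ha'τ : a' < τ₀ := max_lt ha (by linarith)
  have hb'τ : τ₀ < b' := lt_min hb (by linarith)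
  have ha'b' : a' < b' := ha'τ.trans hb'τ
  have hsubo : Ioo a' b' ⊆ Ioo a b := Ioo_subset_Ioo (le_max_left _ _) (min_le_left _ _)
  have hsubc : Icc a' b' ⊆ Icc a b := Icc_subset_Icc (le_max_left _ _) (min_le_left _ _)
  have hlow : ∀ τ ∈ Ioo a' b', ENNReal.ofReal (m ^ 2) ≤ ‖f τ‖ₑ ^ 2 := by
    intro τ hτ
    have hdist : dist τ τ₀ < δ := by
      rw [Real.dist_eq, abs_lt]
      constructor <;> linarith [hτ.1, hτ.2, le_max_right a (τ₀ - δ / 2), min_le_right b (τ₀ + δ / 2)]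
    have h1 : m ≤ ‖f τ‖ := by
      have h2 : ‖f τ₀‖ - ‖f τ‖ ≤ ‖f τ - f τ₀‖ := by
        rw [← norm_neg (f τ - f τ₀), neg_sub]; exact norm_sub_norm_le _ _
      have h3 : ‖f τ - f τ₀‖ < m := by rw [← dist_eq_norm]; exact hδf hdist
      linarith
    calc ENNReal.ofReal (m ^ 2) ≤ ENNReal.ofReal (‖f τ‖ ^ 2) := ENNReal.ofReal_le_ofReal (by gcongr)
      _ = ‖f τ‖ₑ ^ 2 := by rw [← ofReal_norm, ENNReal.ofReal_pow (norm_nonneg _)]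
  -- hence `∫_{(a',b')} v ∘ ρ < ∞`
  have hfin : ∫⁻ τ in Ioo a' b', v (ρ τ) ≠ ⊤ := by
    have hm2 : ENNReal.ofReal (m ^ 2) ≠ 0 := (ENNReal.ofReal_pos.2 (by positivity)).ne'
    have h1 : ENNReal.ofReal (m ^ 2) * ∫⁻ τ in Ioo a' b', v (ρ τ) ≤ ∫⁻ τ in Ioo a b, v (ρ τ) * ‖f τ‖ₑ ^ 2 := by
      rw [← lintegral_const_mul' _ _ ENNReal.ofReal_ne_top]
      calc ∫⁻ τ in Ioo a' b', ENNReal.ofReal (m ^ 2) * v (ρ τ) ≤ ∫⁻ τ in Ioo a' b', v (ρ τ) * ‖f τ‖ₑ ^ 2 := by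
            refine setLIntegral_mono' measurableSet_Ioo fun τ hτ => ?_
            rw [mul_comm]
            gcongr
            exact hlow τ hτ
        _ ≤ ∫⁻ τ in Ioo a b, v (ρ τ) * ‖f τ‖ₑ ^ 2 := lintegral_mono_set hsubo
    intro htop
    rw [htop, ENNReal.mul_top hm2, top_le_iff] at h1
    exact hE h1
  -- change variables on `(a', b')`
  have hinj : InjOn ρ (Ioo a' b') := by
    rcases hmono with h | h
    · exact (h.mono (hsubo.trans Ioo_subset_Icc_self)).injOn
    · exact (h.mono (hsubo.trans Ioo_subset_Icc_self)).injOn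
  have hderiv' : ∀ τ ∈ Ioo a' b', HasDerivWithinAt ρ (ρ' τ) (Ioo a' b') τ := fun τ hτ =>
    (hderiv τ (hsubo hτ)).mono hsubo
  have himg := lintegral_uIoo_image_le ha'b' (hcont.mono hsubc) hinj hderiv' (fun τ hτ => hK τ (hsubo hτ)) v
  have himg_fin : ∫⁻ r in uIoo (ρ a') (ρ b'), v r ≠ ⊤ :=
    ne_top_of_le_ne_top (ENNReal.mul_ne_top ENNReal.ofReal_ne_top hfin) himg
  -- `ρ τ₀` lies strictly inside `uIoo (ρ a') (ρ b')`
  obtain ⟨ε, hε, hεsub⟩ : ∃ ε : ℝ, 0 < ε ∧ Ioo (ρ τ₀ - ε) (ρ τ₀ + ε) ⊆ uIoo (ρ a') (ρ b') := by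
    have ha'I : a' ∈ Icc a b := hsubc (left_mem_Icc.2 ha'b'.le)
    have hb'I : b' ∈ Icc a b := hsubc (right_mem_Icc.2 ha'b'.le)
    have hτI : τ₀ ∈ Icc a b := ⟨ha.le, hb.le⟩
    rcases hmono with h | h
    · have h1 : ρ a' < ρ τ₀ := h ha'I hτI ha'τ
      have h2 : ρ τ₀ < ρ b' := h hτI hb'I hb'τ
      refine ⟨min (ρ τ₀ - ρ a') (ρ b' - ρ τ₀), lt_min (by linarith) (by linarith), ?_⟩
      rw [uIoo_of_le (h1.trans h2).le]
      exact Ioo_subset_Ioo (by linarith [min_le_left (ρ τ₀ - ρ a') (ρ b' - ρ τ₀)])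
        (by linarith [min_le_right (ρ τ₀ - ρ a') (ρ b' - ρ τ₀)])
    · have h1 : ρ τ₀ < ρ a' := h ha'I hτI ha'τ
      have h2 : ρ b' < ρ τ₀ := h hτI hb'I hb'τ
      refine ⟨min (ρ a' - ρ τ₀) (ρ τ₀ - ρ b'), lt_min (by linarith) (by linarith), ?_⟩
      rw [uIoo_of_ge (h2.trans h1).le]
      exact Ioo_subset_Ioo (by linarith [min_le_right (ρ a' - ρ τ₀) (ρ τ₀ - ρ b')])
        (by linarith [min_le_left (ρ a' - ρ τ₀) (ρ τ₀ - ρ b')])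
  have htop : ∫⁻ r in Ioo (ρ τ₀ - ε) (ρ τ₀ + ε), v r = ⊤ := lintegral_Ioo_eq_top_of_mem_hardRad hv hhard hε
  exact himg_fin (eq_top_iff.2 (htop ▸ lintegral_mono_set hεsub))

end Literature.MathematicalPhysics.QuantumManyBody.BoseGas

end
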